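import Summits.BirchSwinnertonDyer.Rank1Residual.X4.KuriharaParityVanishing
import Summits.BirchSwinnertonDyer.Rank1Residual.Additive.PlusSymbolIntegrality
import Literature.NumberTheory.EllipticCurves.PAdicLFunctionDistributionHoldsProofs
import Literature.NumberTheory.EllipticCurves.NewformSymmSquareJ1728Hecke
import Summits.BirchSwinnertonDyer.BirchSwinnertonDyer.Theorems.PlecticLegsTwistSupplyStubPrimeRankCase
import HarnessLib

/-!
# The parity of Kurihara numbers for the NEWFORM OF AN ELLIPTIC CURVE with `E[p]` irreducible: the mod-`p` Hecke relation discharged, so that only the Fricke sign remains (cell `b2b-bsdres`, seat additive-p4 gen 20, line V39c part 2; class-free instrument scope)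

HONEST FRAMING (verbatim, cell `b2b-bsdres`): the goal of the cell is to DELETE the COMBINATION-SHAPED
residual classes for ALL analytic-rank `≤ 1` curves over `ℚ` — "full BSD formula for every rank `≤ 1`
curve in class `C`" assembled STRICTLY from published theorems — so that the rank-`≤ 1` remainder
becomes exactly the CONSTRUCTION-SHAPED classes, which are TYPED (missing-input Props), NOT attempted;
this is not "finishing BSD". This file: class-free kernel bookkeeping (no named fact, no conjecture,
nothing booked; labels unchanged).

## What is here

`KuriharaParityVanishing.lean` proves that the mod-`p` Kurihara numbers of a Fricke eigenform
`w_N f = −σ f` vanish at every Kolyvagin level `n` with `σ·(−1)^{ν(n)} = −1`, GIVEN the mod-`p` Hecke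
relation of the plus symbol at the Kolyvagin primes (binder `hH`). Here that binder is DISCHARGED for
the newform `f` of an elliptic curve `E = W/ℚ` with `E[p]` irreducible and `p` odd:
* (reused) `primeRankCase_ratCast_sum_zmod` — `ℚ → ℤ/p` is additive on `p`-integral rationals;
* `heckeRel_ratCast_ratPlusSymbol_of_irreducible` — the weight-`2` Hecke relation
  `a_q [r]⁺ = ∑_{j mod q} [(r+j)/q]⁺ + [q r]⁺` (MTT §I.4 (4.2), tree theorem `intCast_mul_ratPlusSymbol`,
  Manin–Drinfeld rationality `ratCast_ratPlusSymbol_holds`, `a_q(f) = a_q(E)` for `q ∤ N`) reduced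
  mod `p`, every symbol being `p`-integral by `Additive.norm_ratPlusSymbol_le_one_of_irreducible`
  (p09, gen 2): `HeckeRel (r ↦ [r]⁺_f mod p) q (a_q(E))` for every prime `q ∤ N`;
* **`kuriharaNumber_eq_zero_of_fricke_sign_of_irreducible`** — for `W` globally minimal elliptic, `p`
  odd, `E[p]` irreducible, `f` its newform at the conductor level `N` with Fricke sign
  `w_N f = −σ f` (`σ = w_E`, the root number): `kuriharaNumber f p n ψ = 0` for every
  `n ∈ 𝒩_1(E,p)` with `σ·(−1)^{ν(n)} = −1` and EVERY `ψ`. EVEN analytic rank (`w_E = +1`): all levels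
  with an ODD number of primes are blind; ODD analytic rank: all levels with an EVEN number of primes.

Instrument scope for the Kurihara lanes (E2-AT3, KURX, KUR5, T-N10K, T-a4-LK) and for this seat's
own evidence: rank-`0` statistics must be taken over `ν(n)` EVEN (pairs, quadruples); single-prime
"all `δ̃_q ≡ 0`" observations carry no information. Nothing booked.

## References

* B. Mazur, J. Tate, J. Teitelbaum, Invent. Math. 84 (1986), §I.4 (4.2), §I.8, §I.17. [cite: MazurTateTeitelbaum1986Invent, §I.4 (4.2)]
* C.-H. Kim, Amer. J. Math. 148 (2026), §1.2.2, §1.4.1, §1.4.3. [cite: Kim2022StructureSelmer, §1.4.1 and §1.4.3 (PDF p. 7)]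
* J. Silverman, AEC (2009), §C.16. [cite: SilvermanAEC2009, §C.16 (definition of L_E(s))]
-/

noncomputable section

open scoped MatrixGroups ModularForm

open CongruenceSubgroup Finset

open Literature.NumberTheory.EllipticCurves Literature.NumberTheory.EllipticCurves.ModularForms

namespace Summit.BirchSwinnertonDyer.Rank1Residual.LevelLowering

/-! ### §1 `ℚ → ℤ/p` on `p`-integral rationals: the tree's `primeRankCase_ratCast_sum_zmod`
(`Summits/BirchSwinnertonDyer/BirchSwinnertonDyer/Theorems/PlecticLegsTwistSupplyStubPrimeRankCase.lean`)
is reused — the cast is additive over a Finset sum of rationals with denominators prime to `p`. -/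

/-! ### §2 The mod-`p` Hecke relation of the plus symbol of `f_E`, `E[p]` irreducible -/

variable {W : WeierstrassCurve ℚ} [W.IsElliptic] [W.IsGloballyMinimal] {p : ℕ} [Fact p.Prime]
  {N : ℕ} [NeZero N] {f : CuspForm (Gamma0 N) 2}

/-- **The weight-`2` Hecke relation of the plus symbol, reduced mod `p`**: for the newform `f` of an
elliptic curve `E = W/ℚ` (`W` globally minimal), `p` odd with `E[p]` irreducible (so that EVERY
`[r]⁺_f` is `p`-integral, `Additive.norm_ratPlusSymbol_le_one_of_irreducible`), and a prime `q ∤ N`: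
`∑_{j mod q} [(r+j)/q]⁺ + [q r]⁺ ≡ a_q(E)·[r]⁺ (mod p)` for every `r ∈ ℚ` — `HeckeRel` for
`r ↦ [r]⁺_f mod p` with eigenvalue `a_q(E)` (MTT §I.4 (4.2) = tree `intCast_mul_ratPlusSymbol`, with
Manin–Drinfeld rationality `ratCast_ratPlusSymbol_holds` and `a_q(f) = a_q(E)`).
[cite: MazurTateTeitelbaum1986Invent, §I.4 (4.2)] [cite: SilvermanAEC2009, §C.16 (definition of L_E(s))] -/
theorem heckeRel_ratCast_ratPlusSymbol_of_irreducible (hp2 : p ≠ 2) (hf : IsNewformOf W f)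
    (hirr : W.HasIrreducibleModPGaloisRep p) {q : ℕ} (hq : q.Prime) (hqN : ¬ q ∣ N) :
    HeckeRel (fun r : ℚ ↦ ((ratPlusSymbol f r : ℚ) : ZMod p)) q (W.frobeniusTrace q : ZMod p) := by
  intro r
  have hden : ∀ r : ℚ, ¬ p ∣ (ratPlusSymbol f r).den := fun r ↦
    not_dvd_den_of_norm_ratCast_le_one (Additive.norm_ratPlusSymbol_le_one_of_irreducible hp2 hf hirr r)
  have hne : ∀ r : ℚ, ((ratPlusSymbol f r).den : ZMod p) ≠ 0 := fun r ↦
    (ZMod.natCast_eq_zero_iff _ _).not.mpr (hden r)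
  have hrat : ∀ r : ℚ, (ratPlusSymbol f r : ℝ) = normalizedPlusSymbol f r :=
    fun r ↦ ratCast_ratPlusSymbol_holds hf.1 hf.coeffField_eq_bot r
  have hap : cuspCoeff f q = ((W.frobeniusTrace q : ℤ) : ℂ) :=
    hf.cuspCoeff_eq_frobeniusTrace_of_not_dvd hq hqN
  haveI : NeZero q := ⟨hq.ne_zero⟩
  have H := intCast_mul_ratPlusSymbol q hf.1 hq hqN hap hrat r
  -- cast `H : a_q [r] = ∑_{j : Fin q} [(r+j)/q] + [q r]` to `ZMod p`
  have Hc := congrArg (fun x : ℚ ↦ (x : ZMod p)) H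
  obtain ⟨hsum, hsumden⟩ :=
    Summit.BirchSwinnertonDyer.BirchSwinnertonDyer.Theorems.primeRankCase_ratCast_sum_zmod (p := p)
      (Finset.univ : Finset (Fin q)) (fun j : Fin q ↦ ratPlusSymbol f ((r + j) / q)) (fun j _ ↦ hden _)
  rw [Rat.cast_mul_of_ne_zero (by simp) (hne r), Rat.cast_intCast,
    Rat.cast_add_of_ne_zero ((ZMod.natCast_eq_zero_iff _ _).not.mpr hsumden) (hne _), hsum] at Hc
  rw [Finset.sum_range (fun j ↦ ((ratPlusSymbol f ((r + j) / q) : ℚ) : ZMod p)), ← Hc]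

/-! ### §3 The parity vanishing for `f_E`, `E[p]` irreducible, `p` odd -/

/-- **PARITY VANISHING of the mod-`p` Kurihara numbers of `f_E`.** `W/ℚ` globally minimal elliptic,
`p` an odd prime with `E[p]` irreducible, `f` the newform of `E` at the conductor level `N` (`hN`),
with FRICKE sign `w_N f = −σ f`, `σ = 1` or `−1` (`σ = w_E`, the root number). Then for every
`n ∈ 𝒩_1(E,p)` with `σ·(−1)^{ν(n)} = −1` and every `ψ`: `kuriharaNumber f p n ψ = 0`. In EVEN
analytic rank every level with an ODD number of primes is blind (in particular all single-prime
levels); in ODD analytic rank every level with an EVEN number of primes. No hypothesis on the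
reduction type at `p`; class-free. [cite: MazurTateTeitelbaum1986Invent, §I.17 and §I.4 (4.2)]
[cite: Kurihara2014, §1.1] [cite: Kim2022StructureSelmer, §1.2.2 and §1.4.3 (PDF pp. 5, 7)] -/
theorem kuriharaNumber_eq_zero_of_fricke_sign_of_irreducible (hp2 : p ≠ 2) (hf : IsNewformOf W f)
    (hN : W.conductorNorm ℤ = N) (hirr : W.HasIrreducibleModPGaloisRep p) {σ : ℤ}
    (hσ : σ = 1 ∨ σ = -1) (hε : atkinLehnerInvolution N 2 N f = (-(σ : ℂ)) • f)
    {n : ℕ} [NeZero n] (hn : Kato.IsKolyvaginProduct W p 1 n)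
    (hsign : (σ : ZMod p) * (-1) ^ n.primeFactors.card = -1)
    (ψ : (q : ℕ) → (ZMod q)ˣ →* Multiplicative (ZMod p)) : kuriharaNumber f p n ψ = 0 := by
  have hNn : N.Coprime n := by
    have := hn.coprime
    rw [hN] at this
    exact (Nat.Coprime.coprime_dvd_right (dvd_mul_right N p) this).symm
  refine kuriharaNumber_eq_zero_of_fricke_of_sign W p f hp2 hσ hε (fun q hq ↦ ?_) hn hNn hsign ψ
  have hqN : ¬ q ∣ N := by rw [← hN]; exact hq.not_dvd_conductorNorm
  exact heckeRel_ratCast_ratPlusSymbol_of_irreducible hp2 hf hirr hq.prime hqN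

end Summit.BirchSwinnertonDyer.Rank1Residual.LevelLowering

end
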